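import Literature.NumberTheory.LFunctions.SiegelMordellIntegral
import HarnessLib

/-!
# The Mordell integral `∫ e^{2πix²+2πiwx}/(e^{2πix} − 1) dx` along a line of slope one (Gabcke 1979, Satz 4.1.1, case `m = 2`, `n = 1`)

Topic `Literature/NumberTheory/LFunctions`. Sequel of `SiegelMordellIntegral.lean`, which evaluates Riemann's
integral `∫ e^{πix²+2πiwx}/(e^{πix} − e^{−πix}) dx` (quadratic coefficient `πi`, Gabcke's `Φ(x, 1)`). The leading
term `C₀ = F` of the Riemann–Siegel formula for `Z(t)` is, in Siegel's integral representation, the Mordell integral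
with the DOUBLED quadratic coefficient `2πi` (Gabcke's `Φ(x, 2)`, thesis §4.1, used in Satz 4.1.2 to put his
`F̃(q)` in closed form). Here, with the same method as the first file (two difference equations: a Gaussian integral
and the residue theorem between parallel lines of slope one, `Literature.Analysis.Complex.integral_slant_div_sin_sub_eq_sum`):

* `Literature.NumberTheory.LFunctions.SiegelIntegral.mordellTwoKernel w x = e^{2πix²+2πiwx}/(e^{2πix} − 1)` and
  `Literature.NumberTheory.LFunctions.SiegelIntegral.mordellPhiTwo c w = (1+i) ∫ K_w(c + u(1+i)) du` — the integral
  over the line of slope one through the real point `c`, traversed upwards (Gabcke's `0↗1` for `c ∈ (0,1)`);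
* `mordellPhiTwo_add_one`: `Φ_c(w+1) − Φ_c(w) = ((1+i)/2) e^{−πiw²/2}` (the numerator `e^{2πix} − 1` cancels the
  denominator; a Gaussian integral, `integral_cexp_quadratic`);
* `mordellPhiTwo_succ`: `Φ_{c+1}(w) = e^{2πiw} Φ_c(w+2)` (translation of the line by one);
* `mordellPhiTwo_sub_eq_sum`: `Φ_{c₂}(w) − Φ_{c₁}(w) = Σ_{c₁<n<c₂} e^{2πinw}` (the residues `e^{2πinw}/(2πi)` at the
  integers between the lines);
* **`mordellPhiTwo_mul_eq`** (the closed form, multiplied out, valid for every `w` and every non-integer `c`):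
  `Φ_c(w) (e^{2πiw} − 1) = e^{2πinw} − e^{2πiw} ((1+i)/2) (e^{−πiw²/2} + e^{−πi(w+1)²/2})`, `n = ⌊c⌋ + 1`, and
  **`mordellPhiTwo_eq`**: Gabcke's printed Satz 4.1.1 for `m = 2`, `n = 1`, lines through `(0,1)`:
  `Φ(x, 2) = [e^{2πix} − 2^{−1/2} e^{iπ(1/4 − x²/2)} (e^{−iπ/2 + iπx} + e^{2πix})] / (e^{2πix} − 1)` for
  `e^{2πix} ≠ 1`;
* `rsLeadIntegral_mul_two_cos` — the form in which the Riemann–Siegel leading term arises from Siegel's integral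
  representation: for a non-integer `a > 0`, `N = ⌊a⌋`, over `x = a + u(1+i)`,
  `[(1+i) ∫ e^{2πi(x−a)²}/(2i sin πx) du] · 2 cos 2πa = (−1)^N e^{i(2πa² − (4N+2)πa)} + √2 i e^{iπ/8} sin πa`
  (Gabcke's computation with `m = 2`, `n = 1`, `x = 1/2 − 2p`, proof of Satz 4.1.2), and its real-part form
  `two_mul_re_rsLeadTerm_mul_cos`: `2 Re(−e^{−iπ/8} · integral) · cos 2πa = (−1)^{N+1} cos(2πa² − (4N+2)πa − π/8)`, which is
  `(−1)^{N−1} F(z) cos 2πa /…` in Gabcke's variables `z = 1 − 2(a − N)`, `F(z) = cos π(z²/2 + 3/8)/cos πz` (the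
  translation to `z` is left to the user: it is trigonometry in `a − N`).

Everything here is proved; no named facts. What is NOT here: general rational `τ = m/n` (Gabcke's Satz 4.1.1 in
full, the reciprocity formula for Mordell integrals / generalized Gauss sums), and any estimate.

## References

* W. Gabcke, *Neue Herleitung und explizite Restabschätzung der Riemann-Siegel-Formel*, Dissertation, Göttingen
  1979, §4.1 Satz 4.1.1 (p. 61) and the computation with `m = 2`, `n = 1`, `x = 1/2 − 2p` in the proof of Satz 4.1.2
  (p. 62). [Gabcke1979]
* C. L. Siegel, *Über Riemanns Nachlaß zur analytischen Zahlentheorie* (1932), §1 (the method of the two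
  difference equations). [Siegel1932]
-/

noncomputable section

open Complex MeasureTheory Set Filter Real
open scoped Topology

namespace Literature.NumberTheory.LFunctions

namespace SiegelIntegral

/-! ## The kernel and the line integral -/

/-- Gabcke's integrand for `τ = 2`: `K_w(x) = e^{2πix² + 2πiwx}/(e^{2πix} − 1)`.
[cite: Gabcke1979, §4.1 Satz 4.1.1] -/
def mordellTwoKernel (w x : ℂ) : ℂ :=
  cexp (2 * π * I * x ^ 2 + 2 * π * I * w * x) / (cexp (2 * π * I * x) - 1)

/-- `Φ_c(w) = (1+i) ∫ e^{2πix²+2πiwx}/(e^{2πix} − 1) du` over the line `x = c + u(1+i)` of slope one through the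
real point `c`, traversed upwards (`dx = (1+i) du`); for `0 < c < 1` this is Gabcke's `Φ(w, 2)`.
[cite: Gabcke1979, §4.1 Satz 4.1.1] -/
def mordellPhiTwo (c : ℝ) (w : ℂ) : ℂ := (1 + I) * ∫ u : ℝ, mordellTwoKernel w (line c u)

/-- The numerator of the kernel in the generic shape of `SiegelMordellIntegral.lean`:
`h_w(x) = (2i)⁻¹ e^{πix²} · e^{πix² + (2πiw − πi)x}`. [folklore] -/
def mordellTwoNum (w x : ℂ) : ℂ :=
  ((2 * I)⁻¹ * cexp (π * I * x ^ 2)) * cexp (π * I * x ^ 2 + (2 * π * I * w - π * I) * x)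

/-- `h_w` is entire. [folklore] -/
private lemma differentiable_mordellTwoNum (w : ℂ) : Differentiable ℂ (mordellTwoNum w) := by
  have : mordellTwoNum w = fun x ↦
      ((2 * I)⁻¹ * cexp (π * I * x ^ 2)) * cexp (π * I * x ^ 2 + (2 * π * I * w - π * I) * x) := rfl
  rw [this]; fun_prop

/-- `K_w(x) = h_w(x)/sin(πx)` (`e^{2πix} − 1 = e^{πix} · 2i sin(πx)`). [folklore] -/
private lemma mordellTwoKernel_eq (w x : ℂ) :
    mordellTwoKernel w x = mordellTwoNum w x / Complex.sin (π * x) := by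
  simp only [mordellTwoKernel, mordellTwoNum, cexp_two_pi_I_mul_sub_one]
  have hexp : cexp (π * I * x) ≠ 0 := Complex.exp_ne_zero _
  have h2I : (2 : ℂ) * I ≠ 0 := mul_ne_zero two_ne_zero I_ne_zero
  have e1 : cexp (2 * π * I * x ^ 2 + 2 * π * I * w * x)
      = cexp (π * I * x) * (cexp (π * I * x ^ 2) * cexp (π * I * x ^ 2 + (2 * π * I * w - π * I) * x)) := by
    rw [← Complex.exp_add, ← Complex.exp_add]; ring_nf
  rw [e1]
  field_simp

/-- `e^{πin²} e^{πin²} = 1` for an integer `n`. [folklore] -/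
private lemma cexp_pi_I_sq_mul_self (n : ℤ) : cexp (π * I * (n : ℂ) ^ 2) * cexp (π * I * (n : ℂ) ^ 2) = 1 := by
  rw [← Complex.exp_add, show (π : ℂ) * I * (n : ℂ) ^ 2 + π * I * (n : ℂ) ^ 2 = ((n ^ 2 : ℤ) : ℂ) * (2 * π * I) by
    push_cast; ring, Complex.exp_int_mul_two_pi_mul_I]

/-- `(−1)ⁿ h_w(n) = (2i)⁻¹ e^{2πinw}` at an integer `n` (`e^{πin²} e^{πin²} = 1`, `e^{−πin} = (−1)ⁿ`). [folklore] -/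
private lemma neg_one_zpow_mul_mordellTwoNum_int (w : ℂ) (n : ℤ) :
    (-1 : ℂ) ^ n * mordellTwoNum w n = (2 * I)⁻¹ * cexp (2 * π * I * n * w) := by
  simp only [mordellTwoNum]
  have hsq := cexp_pi_I_sq_mul_self n
  have h2 : cexp (π * I * (n : ℂ) ^ 2 + (2 * π * I * w - π * I) * n)
      = cexp (π * I * (n : ℂ) ^ 2) * cexp (2 * π * I * n * w) * cexp ((-n : ℤ) * (π * I)) := by
    rw [← Complex.exp_add, ← Complex.exp_add]; push_cast; ring_nf
  have h3 : cexp ((-n : ℤ) * (π * I)) = (-1 : ℂ) ^ (-n) := by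
    rw [Complex.exp_int_mul, Complex.exp_pi_mul_I]
  rw [h2, h3]
  have h4 : (-1 : ℂ) ^ (-n) * ((-1 : ℂ) ^ n) = 1 := by
    rw [← zpow_add₀ (by norm_num : (-1 : ℂ) ≠ 0)]; simp
  linear_combination ((2 * I)⁻¹ * cexp (2 * π * I * n * w) * cexp (π * I * (n : ℂ) ^ 2)
      * cexp (π * I * (n : ℂ) ^ 2)) * h4 + ((2 * I)⁻¹ * cexp (2 * π * I * n * w)) * hsq

/-! ## Majorants: the extra Gaussian factor `e^{πix²}` is bounded along every line of slope one -/

/-- `‖e^{πix²}‖ = e^{−2πu² − 2πcu} ≤ e^{πc²/2}` at `x = c + u(1+i)`. [folklore] -/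
private lemma norm_cexp_pi_I_sq_line_le (c u : ℝ) :
    ‖cexp (π * I * (line c u) ^ 2)‖ ≤ Real.exp (π * c ^ 2 / 2) := by
  have h := norm_cexp_quadPhase 0 c u
  simp only [zero_mul, add_zero, zero_re, zero_im, sub_zero] at h
  rw [h]
  refine Real.exp_le_exp.2 ?_
  nlinarith [sq_nonneg (u + c / 2), Real.pi_pos]

/-- `‖(2i)⁻¹ e^{πix²}‖ ≤ ½ e^{πc²/2}` along the line through `c`. [folklore] -/
private lemma norm_mordellTwoWeight_le (c u : ℝ) :
    ‖(2 * I)⁻¹ * cexp (π * I * (line c u) ^ 2)‖ ≤ 1 / 2 * Real.exp (π * c ^ 2 / 2) := by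
  rw [norm_mul]
  have h1 : ‖(2 * I : ℂ)⁻¹‖ = 1 / 2 := by norm_num [norm_inv, norm_mul, Complex.norm_I]
  rw [h1]
  exact mul_le_mul_of_nonneg_left (norm_cexp_pi_I_sq_line_le c u) (by norm_num)

/-- Integrability of `K_w` along the line through a point at distance `≥ d > 0` from the integers ("Das Integral
konvergiert für jedes komplexe x"). [cite: Gabcke1979, §4.1 Satz 4.1.1] -/
lemma integrable_mordellTwoKernel_line (w : ℂ) {c d : ℝ} (hd0 : 0 < d) (hd : ∀ n : ℤ, d ≤ |c - n|) :
    Integrable fun u : ℝ ↦ mordellTwoKernel w (line c u) := by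
  have h := integrable_mul_cexp_quadPhase_div_sin
    (g := fun u : ℝ ↦ (2 * I)⁻¹ * cexp (π * I * (line c u) ^ 2)) (by fun_prop)
    (C := 1 / 2 * Real.exp (π * c ^ 2 / 2)) (N := 0)
    (fun u ↦ by simpa using norm_mordellTwoWeight_le c u) (2 * π * I * w - π * I) hd0 hd
  refine h.congr (Eventually.of_forall fun u ↦ ?_)
  simp only [mordellTwoKernel_eq, mordellTwoNum]

/-- A non-integer real number keeps a positive distance from the integers. [folklore] -/
private lemma exists_pos_le_abs_sub_int' {c : ℝ} (hcn : ∀ n : ℤ, (n : ℝ) ≠ c) :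
    ∃ d : ℝ, 0 < d ∧ ∀ n : ℤ, d ≤ |c - n| := by
  refine ⟨min (Int.fract c) (1 - Int.fract c), ?_, fun n ↦ ?_⟩
  · have h1 : 0 < Int.fract c := Int.fract_pos.2 fun h ↦ hcn ⌊c⌋ h.symm
    have h3 : Int.fract c < 1 := Int.fract_lt_one c
    exact lt_min h1 (by linarith)
  · have hc : c = ⌊c⌋ + Int.fract c := (Int.floor_add_fract c).symm
    rcases le_or_gt n ⌊c⌋ with h | h
    · have h' : (n : ℝ) ≤ ⌊c⌋ := by exact_mod_cast h
      rw [abs_of_nonneg (by linarith [Int.fract_nonneg c])]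
      exact (min_le_left _ _).trans (by linarith)
    · have h' : (⌊c⌋ : ℝ) + 1 ≤ n := by exact_mod_cast h
      rw [abs_of_nonpos (by linarith [Int.fract_lt_one c])]
      exact (min_le_right _ _).trans (by linarith)

/-- Integrability along the line through any non-integer `c` ("Das Integral konvergiert für jedes komplexe x").
[cite: Gabcke1979, §4.1 Satz 4.1.1] -/
lemma integrable_mordellTwoKernel_line' (w : ℂ) {c : ℝ} (hc : ∀ n : ℤ, (n : ℝ) ≠ c) :
    Integrable fun u : ℝ ↦ mordellTwoKernel w (line c u) := by
  obtain ⟨d, hd0, hd⟩ := exists_pos_le_abs_sub_int' hc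
  exact integrable_mordellTwoKernel_line w hd0 hd

/-! ## First difference equation: a Gaussian integral -/

/-- Pointwise: `K_{w+1}(x) − K_w(x) = e^{2πix² + 2πiwx}` wherever `sin(πx) ≠ 0`. [cite: Gabcke1979, §4.1 Satz 4.1.1] -/
lemma mordellTwoKernel_add_one_sub (w : ℂ) {x : ℂ} (hx : Complex.sin (π * x) ≠ 0) :
    mordellTwoKernel (w + 1) x - mordellTwoKernel w x = cexp (2 * π * I * x ^ 2 + 2 * π * I * w * x) := by
  simp only [mordellTwoKernel]
  have hden : cexp (2 * π * I * x) - 1 ≠ 0 := by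
    rw [cexp_two_pi_I_mul_sub_one]
    exact mul_ne_zero (Complex.exp_ne_zero _) (mul_ne_zero (mul_ne_zero two_ne_zero I_ne_zero) hx)
  rw [← sub_div, div_eq_iff hden]
  have e1 : cexp (2 * π * I * x ^ 2 + 2 * π * I * (w + 1) * x)
      = cexp (2 * π * I * x ^ 2 + 2 * π * I * w * x) * cexp (2 * π * I * x) := by
    rw [← Complex.exp_add]; ring_nf
  rw [e1]; ring

/-- `(1/4)^{1/2} = 1/2` in `ℂ` (principal branch). [folklore] -/
private lemma one_div_four_cpow_half : ((π : ℂ) / - -(4 * π)) ^ (1 / 2 : ℂ) = 1 / 2 := by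
  have hπ : (π : ℂ) ≠ 0 := ofReal_ne_zero.2 Real.pi_ne_zero
  have hq : (π : ℂ) / - -(4 * π) = ((1 / 4 : ℝ) : ℂ) := by
    push_cast; field_simp
  rw [hq, show (1 / 2 : ℂ) = ((1 / 2 : ℝ) : ℂ) by push_cast; ring,
    ← Complex.ofReal_cpow (by norm_num : (0:ℝ) ≤ 1 / 4), ← Real.sqrt_eq_rpow,
    show (1 / 4 : ℝ) = (1 / 2) ^ 2 by norm_num, Real.sqrt_sq (by norm_num : (0:ℝ) ≤ 1 / 2)]

/-- The Gaussian integral behind the first difference equation: over `x = c + u(1+i)`,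
`∫ e^{2πix² + 2πiwx} du = ½ e^{−πiw²/2}` (`integral_cexp_quadratic` with `b = −4π`,
`c' = 2πi(1+i)(2c + w)`, `d = 2πic(c + w)`). [folklore] -/
private lemma integral_cexp_two_quadPhase_line (c : ℝ) (w : ℂ) :
    ∫ u : ℝ, cexp (2 * π * I * (line c u) ^ 2 + 2 * π * I * w * line c u) =
      1 / 2 * cexp (-(π * I * w ^ 2 / 2)) := by
  have hb : (-(4 * π) : ℂ).re < 0 := by
    simp only [neg_re, mul_re, re_ofNat, ofReal_re, im_ofNat, ofReal_im, mul_zero, sub_zero]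
    linarith [Real.pi_pos]
  have h := integral_cexp_quadratic hb (2 * π * I * (1 + I) * (2 * c + w)) (2 * π * I * c * (c + w))
  have hfun : (fun u : ℝ ↦ cexp (2 * π * I * (line c u) ^ 2 + 2 * π * I * w * line c u))
      = fun u : ℝ ↦ cexp (-(4 * π) * (u : ℂ) ^ 2 + 2 * π * I * (1 + I) * (2 * c + w) * u
          + 2 * π * I * c * (c + w)) := by
    funext u
    congr 1
    simp only [line]
    linear_combination (2 * (π : ℂ) * (u : ℂ) ^ 2 * (I + 2)) * I_sq
  rw [hfun, h, one_div_four_cpow_half]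
  have hπ : (π : ℂ) ≠ 0 := ofReal_ne_zero.2 Real.pi_ne_zero
  have hsq : (2 * π * I * (1 + I) * (2 * c + w)) ^ 2 = -(8 * π ^ 2) * I * (2 * c + w) ^ 2 := by
    linear_combination (4 * (π : ℂ) ^ 2 * (2 * c + w) ^ 2 * (I ^ 2 + 2 * I)) * I_sq
  congr 1
  congr 1
  rw [hsq]
  field_simp
  ring

/-- **First difference equation**: for a non-integer `c`, `Φ_c(w+1) − Φ_c(w) = ((1+i)/2) e^{−πiw²/2}`.
[cite: Gabcke1979, §4.1 Satz 4.1.1] -/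
theorem mordellPhiTwo_add_one {c : ℝ} (hc : ∀ n : ℤ, (n : ℝ) ≠ c) (w : ℂ) :
    mordellPhiTwo c (w + 1) - mordellPhiTwo c w = (1 + I) / 2 * cexp (-(π * I * w ^ 2 / 2)) := by
  simp only [mordellPhiTwo]
  have h1 := integrable_mordellTwoKernel_line' (w + 1) hc
  have h2 := integrable_mordellTwoKernel_line' w hc
  rw [← mul_sub, ← integral_sub h1 h2]
  have hint : ∫ u : ℝ, (mordellTwoKernel (w + 1) (line c u) - mordellTwoKernel w (line c u))
      = 1 / 2 * cexp (-(π * I * w ^ 2 / 2)) := by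
    rw [← integral_cexp_two_quadPhase_line c w]
    refine integral_congr_ae (Eventually.of_forall fun u ↦ ?_)
    exact mordellTwoKernel_add_one_sub w (sin_pi_line_ne_zero hc u)
  rw [hint]; ring

/-! ## Translation of the line by one -/

/-- Pointwise: `K_w(x + 1) = e^{2πiw} K_{w+2}(x)`. [folklore] -/
private lemma mordellTwoKernel_add_one_arg (w x : ℂ) :
    mordellTwoKernel w (x + 1) = cexp (2 * π * I * w) * mordellTwoKernel (w + 2) x := by
  simp only [mordellTwoKernel]
  have hden : cexp (2 * π * I * (x + 1)) = cexp (2 * π * I * x) := by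
    rw [show 2 * ↑π * I * (x + 1) = 2 * π * I * x + (1 : ℤ) * (2 * π * I) by push_cast; ring,
      Complex.exp_add, Complex.exp_int_mul_two_pi_mul_I, mul_one]
  have hnum : cexp (2 * π * I * (x + 1) ^ 2 + 2 * π * I * w * (x + 1))
      = cexp (2 * π * I * w) * cexp (2 * π * I * x ^ 2 + 2 * π * I * (w + 2) * x) := by
    rw [← Complex.exp_add]
    rw [show 2 * ↑π * I * (x + 1) ^ 2 + 2 * ↑π * I * w * (x + 1)
        = (2 * π * I * w + (2 * π * I * x ^ 2 + 2 * π * I * (w + 2) * x)) + (1 : ℤ) * (2 * π * I) by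
        push_cast; ring,
      Complex.exp_add, Complex.exp_int_mul_two_pi_mul_I, mul_one]
  rw [hden, hnum, mul_div_assoc]

/-- **Translation by one**: `Φ_{c+1}(w) = e^{2πiw} Φ_c(w + 2)`. [cite: Gabcke1979, §4.1 Satz 4.1.1] -/
theorem mordellPhiTwo_succ (c : ℝ) (w : ℂ) :
    mordellPhiTwo (c + 1) w = cexp (2 * π * I * w) * mordellPhiTwo c (w + 2) := by
  suffices key : ∫ u : ℝ, mordellTwoKernel w (line (c + 1) u) =
      cexp (2 * π * I * w) * ∫ u : ℝ, mordellTwoKernel (w + 2) (line c u) by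
    simp only [mordellPhiTwo]; rw [key]; ring
  rw [← MeasureTheory.integral_const_mul]
  refine integral_congr_ae (Eventually.of_forall fun u ↦ ?_)
  simp only
  rw [show line (c + 1) u = line c u + 1 by rw [line_add]; push_cast; ring]
  exact mordellTwoKernel_add_one_arg w (line c u)

/-! ## Second difference equation: the residues at the integers between two lines -/

/-- **The residue theorem between two lines of slope one**: for non-integers `c₁ < c₂`,
`Φ_{c₂}(w) − Φ_{c₁}(w) = Σ_{c₁ < n < c₂} e^{2πinw}` (the residue of `K_w` at `x = n` is `e^{2πinw}/(2πi)`).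
[cite: Gabcke1979, §4.1 Satz 4.1.1] -/
theorem mordellPhiTwo_sub_eq_sum {c₁ c₂ : ℝ} (hc : c₁ < c₂) (hc₁ : ∀ n : ℤ, (n : ℝ) ≠ c₁)
    (hc₂ : ∀ n : ℤ, (n : ℝ) ≠ c₂) (w : ℂ) :
    mordellPhiTwo c₂ w - mordellPhiTwo c₁ w = ∑ n ∈ Finset.Ioc ⌊c₁⌋ ⌊c₂⌋, cexp (2 * π * I * n * w) := by
  simp only [mordellPhiTwo]
  have hker : ∀ x, mordellTwoKernel w x = mordellTwoNum w x / Complex.sin (π * x) := mordellTwoKernel_eq w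
  -- hypotheses of the slope-one residue theorem
  have hint : ∀ c : ℝ, (∀ n : ℤ, (n : ℝ) ≠ c) →
      Integrable fun u : ℝ ↦ mordellTwoNum w (line c u) / Complex.sin (π * line c u) := by
    intro c hcn
    exact (integrable_mordellTwoKernel_line' w hcn).congr (Eventually.of_forall fun u ↦ hker _)
  set M : ℝ := c₁ ^ 2 + c₂ ^ 2 with hM
  have hdecay := decay_mul_cexp_quadPhase_div_sin
    (G := fun z : ℂ ↦ (2 * I)⁻¹ * cexp (π * I * z ^ 2)) (C := 1 / 2 * Real.exp (π * M / 2)) (N := 0)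
    (c₁ := c₁) (c₂ := c₂) (fun c hcI T _ ↦ by
      simp only [pow_zero, mul_one]
      refine (norm_mordellTwoWeight_le c T).trans ?_
      refine mul_le_mul_of_nonneg_left (Real.exp_le_exp.2 ?_) (by norm_num)
      have hc2 : c ^ 2 ≤ M := by
        rw [hM]
        rcases le_or_gt 0 c with h0 | h0
        · nlinarith [hcI.2, sq_nonneg c₁]
        · nlinarith [hcI.1, sq_nonneg c₂]
      nlinarith [Real.pi_pos])
    (2 * π * I * w - π * I)
  have hmain := Literature.Analysis.Complex.integral_slant_div_sin_sub_eq_sum (h := mordellTwoNum w)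
    hc hc₁ hc₂ univ isOpen_univ (subset_univ _) (differentiable_mordellTwoNum w).differentiableOn
    (hint _ hc₁) (hint _ hc₂) (by simpa only [mordellTwoNum] using hdecay)
  have hI : (1 : ℂ) + I ≠ 0 := Literature.Analysis.Complex.one_add_I_ne_zero
  rw [← mul_sub]
  simp only [hker]
  rw [hmain, Finset.mul_sum, Finset.mul_sum]
  refine Finset.sum_congr rfl fun n _ ↦ ?_
  rw [neg_one_zpow_mul_mordellTwoNum_int]
  field_simp

/-! ## The closed form -/

/-- **Gabcke 1979, Satz 4.1.1 for `τ = 2`, multiplied out** (valid for every `w` and every non-integer `c`;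
`n = ⌊c⌋ + 1` is the integer between the lines through `c` and `c + 1`):
`Φ_c(w) (e^{2πiw} − 1) = e^{2πinw} − e^{2πiw} ((1+i)/2) (e^{−πiw²/2} + e^{−πi(w+1)²/2})`. Proof: eliminate
`Φ_{c+1}(w)` and `Φ_c(w+2)` between the translation, the residue and (twice) the first difference equation.
[cite: Gabcke1979, §4.1 Satz 4.1.1] -/
theorem mordellPhiTwo_mul_eq {c : ℝ} (hc : ∀ n : ℤ, (n : ℝ) ≠ c) (w : ℂ) :
    mordellPhiTwo c w * (cexp (2 * π * I * w) - 1) =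
      cexp (2 * π * I * ((⌊c⌋ + 1 : ℤ) : ℂ) * w)
        - cexp (2 * π * I * w) * ((1 + I) / 2 * (cexp (-(π * I * w ^ 2 / 2)) + cexp (-(π * I * (w + 1) ^ 2 / 2)))) := by
  have hc1 : ∀ n : ℤ, (n : ℝ) ≠ c + 1 := fun n h ↦ hc (n - 1) (by push_cast; linarith)
  have hA := mordellPhiTwo_add_one hc w
  have hA' := mordellPhiTwo_add_one hc (w + 1)
  rw [show w + 1 + 1 = w + 2 by ring] at hA'
  have hT := mordellPhiTwo_succ c w
  have hJ := mordellPhiTwo_sub_eq_sum (lt_add_one c) hc hc1 w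
  have hset : Finset.Ioc ⌊c⌋ ⌊c + 1⌋ = {⌊c⌋ + 1} := by
    rw [Int.floor_add_one]
    ext m
    simp only [Finset.mem_Ioc, Finset.mem_singleton]
    omega
  rw [hset, Finset.sum_singleton] at hJ
  linear_combination hJ - hT - cexp (2 * π * I * w) * (hA + hA')

/-- `(1+i)/2 = 2^{−1/2} e^{iπ/4}`. [folklore] -/
private lemma one_add_I_div_two_eq : (1 + I) / 2 = ((Real.sqrt 2 : ℝ) : ℂ)⁻¹ * cexp (π * I / 4) := by
  have h2 : cexp (π * I / 4) = ((Real.sqrt 2 / 2 : ℝ) : ℂ) * (1 + I) := by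
    rw [show (↑π * I / 4 : ℂ) = ((π / 4 : ℝ) : ℂ) * I by push_cast; ring, Complex.exp_mul_I,
      ← Complex.ofReal_cos, ← Complex.ofReal_sin, Real.cos_pi_div_four, Real.sin_pi_div_four]
    push_cast; ring
  rw [h2, ← mul_assoc, ← Complex.ofReal_inv, ← Complex.ofReal_mul]
  have hs : (Real.sqrt 2)⁻¹ * (Real.sqrt 2 / 2) = 1 / 2 := by
    have : Real.sqrt 2 ≠ 0 := by positivity
    field_simp
  rw [hs]; push_cast; ring

/-- **Gabcke 1979, Satz 4.1.1, case `m = 2`, `n = 1`, as printed**: for the line crossing the real axis in `(0, 1)`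
and `e^{2πix} ≠ 1`,
`Φ(x, 2) = [e^{2πix} − 2^{−1/2} e^{iπ(1/4 − x²/2)} (e^{−iπ/2 + iπx} + e^{2πix})] / (e^{2πix} − 1)`.
[cite: Gabcke1979, §4.1 Satz 4.1.1] -/
theorem mordellPhiTwo_eq {c : ℝ} (hc0 : 0 < c) (hc1 : c < 1) {x : ℂ} (hx : cexp (2 * π * I * x) ≠ 1) :
    mordellPhiTwo c x =
      (cexp (2 * π * I * x)
        - ((Real.sqrt 2 : ℝ) : ℂ)⁻¹ * cexp (I * π * (1 / 4 - x ^ 2 / 2))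
            * (cexp (-(I * π / 2) + I * π * x) + cexp (2 * π * I * x)))
        / (cexp (2 * π * I * x) - 1) := by
  have hc : ∀ n : ℤ, (n : ℝ) ≠ c := by
    intro n h
    have h0 : (0 : ℝ) < n := h ▸ hc0
    have h1 : (n : ℝ) < 1 := h ▸ hc1
    have : (0 : ℤ) < n := by exact_mod_cast h0
    have : n < 1 := by exact_mod_cast h1
    omega
  have hfl : ⌊c⌋ = 0 := Int.floor_eq_iff.2 ⟨by simpa using hc0.le, by simpa using hc1⟩
  have h := mordellPhiTwo_mul_eq hc x
  rw [hfl, zero_add, Int.cast_one, one_add_I_div_two_eq] at h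
  rw [eq_div_iff (sub_ne_zero.2 hx), h]
  -- atoms: P = e^{2πix}, P' = e^{−2πix}, G = e^{−πix²/2}, H = e^{−iπ/2 + iπx}, Ω = e^{iπ/4}
  have e1 : cexp (-(↑π * I * (x + 1) ^ 2 / 2)) = cexp (-(π * I * x ^ 2 / 2)) * cexp (-(I * π / 2) + I * π * x)
      * cexp (-(2 * π * I * x)) := by
    rw [← Complex.exp_add, ← Complex.exp_add]; ring_nf
  have e2 : cexp (I * ↑π * (1 / 4 - x ^ 2 / 2)) = cexp (π * I / 4) * cexp (-(π * I * x ^ 2 / 2)) := by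
    rw [← Complex.exp_add]; ring_nf
  have e3 : cexp (2 * ↑π * I * x) * cexp (-(2 * π * I * x)) = 1 := by
    rw [← Complex.exp_add, show 2 * ↑π * I * x + -(2 * π * I * x) = 0 by ring, Complex.exp_zero]
  rw [e1, e2, mul_one]
  linear_combination (-((Real.sqrt 2 : ℝ) : ℂ)⁻¹ * cexp (π * I / 4) * cexp (-(π * I * x ^ 2 / 2))
    * cexp (-(I * π / 2) + I * π * x)) * e3

/-! ## The leading term of the Riemann–Siegel formula in Siegel's representation -/

/-- The kernel of the Riemann–Siegel leading term is Gabcke's `τ = 2` kernel at `w = 1/2 − 2a`: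
`e^{2πi(x−a)²}/(2i sin πx) = e^{2πia²} K_{1/2 − 2a}(x)`. [folklore] -/
private lemma cexp_sq_sub_div_sin_eq (a : ℝ) (x : ℂ) :
    cexp (2 * π * I * (x - a) ^ 2) / (2 * I * Complex.sin (π * x)) =
      cexp (2 * π * I * (a : ℂ) ^ 2) * mordellTwoKernel (1 / 2 - 2 * a) x := by
  simp only [mordellTwoKernel, cexp_two_pi_I_mul_sub_one]
  have hexp : cexp (π * I * x) ≠ 0 := Complex.exp_ne_zero _
  have key : cexp (2 * π * I * (x - a) ^ 2)
      = cexp (2 * π * I * (a : ℂ) ^ 2) * cexp (2 * π * I * x ^ 2 + 2 * π * I * (1 / 2 - 2 * a) * x)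
          / cexp (π * I * x) := by
    rw [eq_div_iff hexp, ← Complex.exp_add, ← Complex.exp_add]
    congr 1; ring
  rw [key, div_div, mul_div_assoc]

/-- The Riemann–Siegel leading-term integral `(1+i) ∫ e^{2πi(x−a)²}/(2i sin πx) du` over the line `x = a + u(1+i)`
equals `e^{2πia²} Φ_a(1/2 − 2a)` (the substitution `x = 1/2 − 2p`, `m = 2`, `n = 1` in the proof of Satz 4.1.2).
[cite: Gabcke1979, §4.1 Satz 4.1.2] -/
lemma rsLeadIntegral_eq_mordellPhiTwo (a : ℝ) :
    (1 + I) * ∫ u : ℝ, cexp (2 * π * I * (line a u - a) ^ 2) / (2 * I * Complex.sin (π * line a u)) =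
      cexp (2 * π * I * (a : ℂ) ^ 2) * mordellPhiTwo a (1 / 2 - 2 * a) := by
  simp only [mordellPhiTwo, cexp_sq_sub_div_sin_eq, MeasureTheory.integral_const_mul]; ring

/-- The Riemann–Siegel leading-term integrand `e^{2πi(x−a)²}/(2i sin πx)` is integrable along the line of slope one
through a non-integer `a` ("die Konvergenz des Integrals [hängt] nicht von q ab", proof of Satz 4.1.2).
[cite: Gabcke1979, §4.1 Satz 4.1.2] -/
lemma integrable_rsLeadKernel_line {a : ℝ} (hai : ∀ n : ℤ, (n : ℝ) ≠ a) :
    Integrable fun u : ℝ ↦ cexp (2 * π * I * (line a u - a) ^ 2) / (2 * I * Complex.sin (π * line a u)) := by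
  have h := (integrable_mordellTwoKernel_line' (1 / 2 - 2 * a) hai).const_mul (cexp (2 * π * I * (a : ℂ) ^ 2))
  refine h.congr (Eventually.of_forall fun u ↦ ?_)
  simp only [cexp_sq_sub_div_sin_eq]

/-- The polynomial identity behind `rsLeadIntegral_mul_two_cos` (all exponentials as atoms: `E = e^{iπa}`,
`Ei = e^{−iπa}`, `A = e^{2πia²}`, `Ai = e^{−2πia²}`, `ω = e^{iπ/8}`, `ωi = e^{−iπ/8}`, `r = √2`, `J = i`). [folklore] -/
private lemma rsLead_aux {X E Ei A Ai ω ωi r J : ℂ} {N : ℕ} (hE : E * Ei = 1) (hA : A * Ai = 1) (hω : ω * ωi = 1)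
    (hr : 1 + J = r * ω ^ 2) (hJ : J * J = -1)
    (h : X * (-Ei ^ 4 - 1) = (-1) ^ (N + 1) * Ei ^ (4 * N + 4)
      - -Ei ^ 4 * ((1 + J) / 2 * (ωi * E * Ai + -(ωi * E ^ 3 * Ai)))) :
    A * X * (2 * ((E ^ 2 + Ei ^ 2) / 2)) = (-1) ^ N * (A * Ei ^ (4 * N + 2)) + r * J * ω * ((Ei - E) * J / 2) := by
  linear_combination (-A * E ^ 2) * h
    + (-A * X * Ei ^ 2 * (E * Ei + 1) + (-1) ^ N * A * Ei ^ (4 * N + 2) * (E * Ei + 1)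
        - Ei * (r * ω / 2) * (1 - E ^ 2) * ((E * Ei) ^ 2 + E * Ei + 1) + (r * ω / 2) * E) * hE
    + (-E ^ 3 * Ei ^ 4 * ((1 + J) / 2) * ωi * (1 - E ^ 2)) * hA
    + (-E ^ 3 * Ei ^ 4 * ωi * (1 - E ^ 2) / 2) * hr
    + (-E ^ 3 * Ei ^ 4 * (r * ω / 2) * (1 - E ^ 2)) * hω
    + (-r * ω * (Ei - E) / 2) * hJ

/-- **The Riemann–Siegel leading-term integral in closed form** (Gabcke's computation with `m = 2`, `n = 1`,
`x = 1/2 − 2p` in the proof of Satz 4.1.2, here directly on the line through the saddle point `a`, the residues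
at `1, …, N` being accounted for by `mordellPhiTwo_mul_eq` with `⌊a⌋ = N`): for a non-integer `a > 0` and
`N = ⌊a⌋`,
`[(1+i) ∫ e^{2πi(x−a)²}/(2i sin πx) du] · 2 cos 2πa = (−1)^N e^{i(2πa² − (4N+2)πa)} + √2 i e^{iπ/8} sin πa`.
[cite: Gabcke1979, §4.1 Satz 4.1.2] -/
theorem rsLeadIntegral_mul_two_cos {a : ℝ} (ha : 0 < a) (hai : ∀ n : ℤ, (n : ℝ) ≠ a) :
    ((1 + I) * ∫ u : ℝ, cexp (2 * π * I * (line a u - a) ^ 2) / (2 * I * Complex.sin (π * line a u)))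
        * (2 * Complex.cos (2 * π * a)) =
      (-1) ^ ⌊a⌋₊ * (cexp (2 * π * I * (a : ℂ) ^ 2) * cexp (-(π * I * a)) ^ (4 * ⌊a⌋₊ + 2))
        + Real.sqrt 2 * I * cexp (π * I / 8) * Complex.sin (π * a) := by
  rw [rsLeadIntegral_eq_mordellPhiTwo]
  set N : ℕ := ⌊a⌋₊ with hN
  have hNz : (⌊a⌋ : ℤ) = (N : ℤ) := by rw [hN, Int.natCast_floor_eq_floor ha.le]
  have h := mordellPhiTwo_mul_eq hai (1 / 2 - 2 * a)
  rw [hNz] at h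
  -- atoms
  set E : ℂ := cexp (π * I * a) with hE
  set Ei : ℂ := cexp (-(π * I * a)) with hEi
  set A : ℂ := cexp (2 * π * I * (a : ℂ) ^ 2) with hA
  set Ai : ℂ := cexp (-(2 * π * I * (a : ℂ) ^ 2)) with hAi
  set ω : ℂ := cexp (π * I / 8) with hω
  set ωi : ℂ := cexp (-(π * I / 8)) with hωi
  have hEEi : E * Ei = 1 := by rw [hE, hEi, ← Complex.exp_add, add_neg_cancel, Complex.exp_zero]
  have hAAi : A * Ai = 1 := by rw [hA, hAi, ← Complex.exp_add, add_neg_cancel, Complex.exp_zero]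
  have hωωi : ω * ωi = 1 := by rw [hω, hωi, ← Complex.exp_add, add_neg_cancel, Complex.exp_zero]
  have hsqrt : ((Real.sqrt 2 : ℝ) : ℂ) * ((Real.sqrt 2 : ℝ) : ℂ) = 2 := by
    rw [← Complex.ofReal_mul, Real.mul_self_sqrt (by norm_num : (0:ℝ) ≤ 2)]; push_cast; ring
  have hs0 : ((Real.sqrt 2 : ℝ) : ℂ) ≠ 0 := by
    rw [Complex.ofReal_ne_zero]; positivity
  have hω2 : cexp (π * I / 4) = ω ^ 2 := by
    rw [hω, ← Complex.exp_nat_mul]; congr 1; push_cast; ring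
  have h1I : (1 : ℂ) + I = ((Real.sqrt 2 : ℝ) : ℂ) * ω ^ 2 := by
    have e := one_add_I_div_two_eq
    rw [hω2] at e
    have : (1 : ℂ) + I = 2 * (((Real.sqrt 2 : ℝ) : ℂ)⁻¹ * ω ^ 2) := by rw [← e]; ring
    rw [this]
    field_simp
    linear_combination (-(ω ^ 2)) * hsqrt
  -- the exponentials in `h` and in the goal, in terms of the atoms
  have h1 : cexp (2 * π * I * (1 / 2 - 2 * (a : ℂ))) = -Ei ^ 4 := by
    rw [show 2 * ↑π * I * (1 / 2 - 2 * (a : ℂ)) = π * I + ((4 : ℕ) : ℂ) * (-(π * I * a)) by push_cast; ring,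
      Complex.exp_add, Complex.exp_pi_mul_I, Complex.exp_nat_mul]
    ring
  have h2 : cexp (2 * π * I * ((((N : ℤ) + 1 : ℤ)) : ℂ) * (1 / 2 - 2 * (a : ℂ))) = (-1) ^ (N + 1) * Ei ^ (4 * N + 4) := by
    have : cexp (2 * π * I * ((((N : ℤ) + 1 : ℤ)) : ℂ) * (1 / 2 - 2 * (a : ℂ))) = (-Ei ^ 4) ^ (N + 1) := by
      rw [← h1, ← Complex.exp_nat_mul]; congr 1; push_cast; ring
    rw [this, neg_pow, ← pow_mul, show 4 * (N + 1) = 4 * N + 4 by ring]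
  have h3 : cexp (-(π * I * (1 / 2 - 2 * (a : ℂ)) ^ 2 / 2)) = ωi * E * Ai := by
    rw [hωi, hE, hAi, ← Complex.exp_add, ← Complex.exp_add]
    congr 1; ring
  have h4 : cexp (-(π * I * (1 / 2 - 2 * (a : ℂ) + 1) ^ 2 / 2)) = -(ωi * E ^ 3 * Ai) := by
    have : -(↑π * I * (1 / 2 - 2 * (a : ℂ) + 1) ^ 2 / 2)
        = (-(π * I / 8) + ((3 : ℕ) : ℂ) * (π * I * a) + -(2 * π * I * (a : ℂ) ^ 2)) - π * I := by
      push_cast; ring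
    rw [this, Complex.exp_sub, Complex.exp_pi_mul_I, Complex.exp_add, Complex.exp_add, Complex.exp_nat_mul]
    ring
  have h6 : Complex.cos (2 * π * a) = (E ^ 2 + Ei ^ 2) / 2 := by
    rw [Complex.cos, show 2 * ↑π * (a : ℂ) * I = ((2 : ℕ) : ℂ) * (π * I * a) by push_cast; ring,
      show -(2 * ↑π * (a : ℂ)) * I = ((2 : ℕ) : ℂ) * (-(π * I * a)) by push_cast; ring,
      Complex.exp_nat_mul, Complex.exp_nat_mul]
  have h7 : Complex.sin (π * a) = (Ei - E) * I / 2 := by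
    rw [Complex.sin, show -(↑π * (a : ℂ)) * I = -(π * I * a) by ring, show ↑π * (a : ℂ) * I = π * I * a by ring]
  rw [h1, h2, h3, h4] at h
  rw [h6, h7]
  exact rsLead_aux hEEi hAAi hωωi h1I Complex.I_mul_I h

/-- **Real-part form of the leading term**: with `T₀ = −e^{−iπ/8} (1+i) ∫ e^{2πi(x−a)²}/(2i sin πx) du` over
`x = a + u(1+i)` (`a > 0` non-integer, `N = ⌊a⌋`),
`2 Re(T₀) · cos 2πa = (−1)^{N+1} cos(2πa² − (4N+2)πa − π/8)`; in Gabcke's variables `z = 1 − 2(a − N)` the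
right-hand side is `(−1)^{N−1} F(z) · cos 2πa` with `F(z) = cos π(z²/2 + 3/8)/cos πz`, `cos 2πa = −cos πz`
(Einleitung (2): `C₀ = F`). [cite: Gabcke1979, §4.1 Satz 4.1.2] -/
theorem two_mul_re_rsLeadTerm_mul_cos {a : ℝ} (ha : 0 < a) (hai : ∀ n : ℤ, (n : ℝ) ≠ a) :
    2 * (-cexp (-(π * I / 8)) * ((1 + I) * ∫ u : ℝ, cexp (2 * π * I * (line a u - a) ^ 2)
        / (2 * I * Complex.sin (π * line a u)))).re * Real.cos (2 * π * a) =
      (-1) ^ (⌊a⌋₊ + 1) * Real.cos (2 * π * a ^ 2 - (4 * ⌊a⌋₊ + 2) * π * a - π / 8) := by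
  set M : ℂ := (1 + I) * ∫ u : ℝ, cexp (2 * π * I * (line a u - a) ^ 2)
        / (2 * I * Complex.sin (π * line a u)) with hM
  have h := rsLeadIntegral_mul_two_cos ha hai
  rw [← hM] at h
  set N : ℕ := ⌊a⌋₊ with hN
  set A : ℂ := cexp (2 * π * I * (a : ℂ) ^ 2) with hA
  set Ei : ℂ := cexp (-(π * I * a)) with hEi
  set ω : ℂ := cexp (π * I / 8) with hω
  set ωi : ℂ := cexp (-(π * I / 8)) with hωi
  set θ : ℝ := 2 * π * a ^ 2 - (4 * N + 2) * π * a - π / 8 with hθ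
  have hcos : ((2 * Real.cos (2 * π * a) : ℝ) : ℂ) = 2 * Complex.cos (2 * π * a) := by
    rw [Complex.ofReal_mul, Complex.ofReal_cos]; push_cast; ring_nf
  have hsin : ((Real.sqrt 2 * Real.sin (π * a) : ℝ) : ℂ) * I = Real.sqrt 2 * I * Complex.sin (π * a) := by
    rw [Complex.ofReal_mul, Complex.ofReal_sin]; push_cast; ring_nf
  have e1 : cexp ((θ : ℂ) * I) = ωi * (A * Ei ^ (4 * N + 2)) := by
    rw [hωi, hA, hEi, hθ, ← Complex.exp_nat_mul, ← Complex.exp_add, ← Complex.exp_add]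
    congr 1; push_cast; ring
  have e2 : ωi * ω = 1 := by rw [hωi, hω, ← Complex.exp_add, neg_add_cancel, Complex.exp_zero]
  have key : (-ωi * M) * ((2 * Real.cos (2 * π * a) : ℝ) : ℂ) =
      (((-1 : ℝ) ^ (N + 1) : ℝ) : ℂ) * cexp ((θ : ℂ) * I) - ((Real.sqrt 2 * Real.sin (π * a) : ℝ) : ℂ) * I := by
    rw [hcos, hsin, mul_assoc, h, e1]
    push_cast
    rw [pow_succ]
    linear_combination (-(Real.sqrt 2 : ℂ) * I * Complex.sin (π * a)) * e2
  have hre := congrArg Complex.re key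
  rw [Complex.re_mul_ofReal, Complex.sub_re, Complex.re_ofReal_mul, Complex.exp_ofReal_mul_I_re,
    Complex.re_ofReal_mul, Complex.I_re, mul_zero, sub_zero] at hre
  linarith [hre]

end SiegelIntegral

end Literature.NumberTheory.LFunctions
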